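import Mathlib
import Summits.ValiantsHypothesis.ValiantsHypothesis.Theorems.NewtonUnitEquationsNewtonTauWeakCornerDefs

/-!
# `NewtonTauWeak` (stmt-ValiantsHypothesis-5904), fixed-`K` coincidence rung at `K = 3`:
# Laurent toolkit — strict minima of bivariate Laurent polynomials under a generic weight

Support file (siege k11, "lines" route) for the sub-stub `fixedKCoincidence_t2_K3` of the open stub
`stub_binomialNewtonTauCommon` (KPTT arXiv:1308.2286 Conj. 1 at `t = 2`, three products, exponent lists
without short 2-vs-1 direction relations).  The local analysis at a common corner of the three binomial
products is carried out in the group algebra `Lau = ℂ[ℤ²]` of bivariate LAURENT polynomials (the flip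
identity `1 - ρ X^d = (-ρ X^d)(1 - ρ⁻¹ X^{-d})` needs negative exponents).  This file provides the
elementary calculus of STRICT MINIMA `SMin(w, a, x)` (the point `x` carries a nonzero coefficient of `a`
and every other support point is strictly heavier for the real weight `w`) and of HEAVY elements
(`Heavy(w, Ω, a)`: every support point weighs at least `Ω`): uniqueness, behaviour under scalar multiples,
sums, products, and the "product of perturbed factors" lemma `prod_add_heavy`.  Weights are the `wt` of
the corner model (`Theorems/NewtonUnitEquationsNewtonTauWeakCornerDefs.lean`).  Everything is [folklore].
-/

set_option linter.dupNamespace false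

noncomputable section

open scoped BigOperators Pointwise
open Summit.ValiantsHypothesis.ValiantsHypothesis.Theorems.NewtonTauWeakCorner (wt wt_add wt_zero)

namespace Summit.ValiantsHypothesis.ValiantsHypothesis.Theorems.NewtonTauWeakK3Lines

/-! Definition-free (D-0016: no new objects in a proof file): the three notions of this toolkit are
NOTATIONS over Mathlib.  `Lau` — bivariate Laurent polynomials over `ℂ`, the group algebra of `ℤ²`;
`SMin(w, a, x)` — `x` is the STRICT `w`-MINIMUM of `a` (nonzero coefficient at `x`, every other support
point strictly heavier); `Heavy(w, Ω, a)` — every support point of `a` weighs at least `Ω`. -/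

local notation3 "Lau" => AddMonoidAlgebra ℂ (Fin 2 → ℤ)

local notation3 "SMin(" w ", " a ", " x ")" =>
  (AddMonoidAlgebra.coeff a x ≠ 0 ∧ ∀ y ∈ (AddMonoidAlgebra.coeff a).support, y ≠ x → wt w x < wt w y)

local notation3 "Heavy(" w ", " Ω ", " a ")" => (∀ y ∈ (AddMonoidAlgebra.coeff a).support, Ω ≤ wt w y)

-- BEGIN BODY
variable {w : Fin 2 → ℝ}

/-! ## Strict minima -/

/-- The minimum point lies in the support. [folklore] -/
theorem smin_mem {a : Lau} {x : Fin 2 → ℤ} (h : SMin(w, a, x)) : x ∈ a.coeff.support :=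
  Finsupp.mem_support_iff.mpr h.1

/-- A Laurent polynomial with a strict minimum is nonzero. [folklore] -/
theorem smin_ne_zero {a : Lau} {x : Fin 2 → ℤ} (h : SMin(w, a, x)) : a ≠ 0 := by
  rintro rfl
  exact h.1 (by simp)

/-- Every support point weighs at least the strict minimum. [folklore] -/
theorem smin_wt_le {a : Lau} {x y : Fin 2 → ℤ} (h : SMin(w, a, x)) (hy : y ∈ a.coeff.support) :
    wt w x ≤ wt w y := by
  by_cases hyx : y = x
  · rw [hyx]
  · exact (h.2 y hy hyx).le

/-- Strict minima are unique. [folklore] -/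
theorem smin_unique {a : Lau} {x y : Fin 2 → ℤ} (hx : SMin(w, a, x)) (hy : SMin(w, a, y)) : x = y := by
  by_contra hxy
  have h1 := hx.2 y (smin_mem hy) (Ne.symm hxy)
  have h2 := hy.2 x (smin_mem hx) hxy
  exact lt_irrefl _ (h1.trans h2)

/-- A nonzero monomial has its exponent as strict minimum. [folklore] -/
theorem smin_single (z : Fin 2 → ℤ) {c : ℂ} (hc : c ≠ 0) :
    SMin(w, AddMonoidAlgebra.single z c, z) := by
  refine ⟨by simpa [AddMonoidAlgebra.coeff_single] using hc, fun y hy hyz => ?_⟩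
  rw [AddMonoidAlgebra.coeff_single, Finsupp.mem_support_iff, Finsupp.single_apply] at hy
  exact absurd (by by_contra h; exact hy (if_neg h)) (Ne.symm hyz)

/-- Strict minima are stable under nonzero scalars. [folklore] -/
theorem smin_smul {a : Lau} {x : Fin 2 → ℤ} (h : SMin(w, a, x)) {c : ℂ} (hc : c ≠ 0) :
    SMin(w, c • a, x) := by
  refine ⟨?_, fun y hy hyx => ?_⟩
  · rw [AddMonoidAlgebra.coeff_smul, Finsupp.smul_apply, smul_eq_mul]
    exact mul_ne_zero hc h.1
  · rw [AddMonoidAlgebra.coeff_smul, Finsupp.mem_support_iff, Finsupp.smul_apply, smul_eq_mul] at hy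
    exact h.2 y (Finsupp.mem_support_iff.mpr (right_ne_zero_of_mul hy)) hyx

/-- Adding an element whose support is strictly heavier than the minimum keeps the strict minimum and its
coefficient. [folklore] -/
theorem smin_add_heavy {a b : Lau} {x : Fin 2 → ℤ} (h : SMin(w, a, x))
    (hb : ∀ y ∈ b.coeff.support, wt w x < wt w y) :
    SMin(w, a + b, x) ∧ (a + b).coeff x = a.coeff x := by
  have hbx : b.coeff x = 0 := by
    by_contra hne
    exact lt_irrefl _ (hb x (Finsupp.mem_support_iff.mpr hne))
  have hcoef : (a + b).coeff x = a.coeff x := by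
    rw [AddMonoidAlgebra.coeff_add, Finsupp.add_apply, hbx, add_zero]
  refine ⟨⟨by rw [hcoef]; exact h.1, fun y hy hyx => ?_⟩, hcoef⟩
  rw [AddMonoidAlgebra.coeff_add] at hy
  rcases Finset.mem_union.mp (Finsupp.support_add hy) with hya | hyb
  · exact h.2 y hya hyx
  · exact hb y hyb

/-- Conversely, removing a strictly heavier part keeps the strict minimum. [folklore] -/
theorem smin_of_add_heavy {a b : Lau} {x : Fin 2 → ℤ} (h : SMin(w, a + b, x))
    (hb : ∀ y ∈ b.coeff.support, wt w x < wt w y) : SMin(w, a, x) := by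
  have hb' : ∀ y ∈ (-b).coeff.support, wt w x < wt w y := by
    intro y hy
    rw [AddMonoidAlgebra.coeff_neg, Finsupp.support_neg] at hy
    exact hb y hy
  have := (smin_add_heavy h hb').1
  rwa [add_neg_cancel_right] at this

/-- The sum of two elements with strict minima of different weights has the lighter one as strict
minimum. [folklore] -/
theorem smin_add_lt {a b : Lau} {x y : Fin 2 → ℤ} (ha : SMin(w, a, x)) (hb : SMin(w, b, y))
    (hlt : wt w x < wt w y) : SMin(w, a + b, x) :=
  (smin_add_heavy ha fun _ hz => hlt.trans_le (smin_wt_le hb hz)).1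

/-- Symmetric form of `smin_add_lt`. [folklore] -/
theorem smin_add_lt' {a b : Lau} {x y : Fin 2 → ℤ} (ha : SMin(w, a, x)) (hb : SMin(w, b, y))
    (hlt : wt w y < wt w x) : SMin(w, a + b, y) := by
  rw [add_comm]; exact smin_add_lt hb ha hlt

/-- **Strict minima multiply**: the product has strict minimum at the sum of the minima, with the product
of the two minimal coefficients (`ℂ` has no zero divisors). [folklore] -/
theorem smin_mul {a b : Lau} {x y : Fin 2 → ℤ} (ha : SMin(w, a, x)) (hb : SMin(w, b, y)) :
    SMin(w, a * b, x + y) ∧ (a * b).coeff (x + y) = a.coeff x * b.coeff y := by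
  classical
  -- weights of sums of support points
  have hkey : ∀ m₁ ∈ a.coeff.support, ∀ m₂ ∈ b.coeff.support, (m₁ ≠ x ∨ m₂ ≠ y) →
      wt w (x + y) < wt w (m₁ + m₂) := by
    intro m₁ h1 m₂ h2 hne
    rw [wt_add, wt_add]
    rcases hne with hne | hne
    · exact add_lt_add_of_lt_of_le (ha.2 m₁ h1 hne) (smin_wt_le hb h2)
    · exact add_lt_add_of_le_of_lt (smin_wt_le ha h1) (hb.2 m₂ h2 hne)
  have hcoef : (a * b).coeff (x + y) = a.coeff x * b.coeff y := by
    rw [AddMonoidAlgebra.coeff_mul]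
    simp only [Finsupp.sum]
    rw [Finset.sum_eq_single x]
    · rw [Finset.sum_eq_single y]
      · rw [if_pos rfl]
      · intro m₂ h2 hne
        rw [if_neg]
        intro heq
        have := hkey x (smin_mem ha) m₂ h2 (Or.inr hne)
        rw [heq] at this
        exact lt_irrefl _ this
      · intro hy; exact absurd (smin_mem hb) hy
    · intro m₁ h1 hne
      refine Finset.sum_eq_zero fun m₂ h2 => ?_
      rw [if_neg]
      intro heq
      have := hkey m₁ h1 m₂ h2 (Or.inl hne)
      rw [heq] at this
      exact lt_irrefl _ this
    · intro hx; exact absurd (smin_mem ha) hx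
  refine ⟨⟨by rw [hcoef]; exact mul_ne_zero ha.1 hb.1, fun m hm hne => ?_⟩, hcoef⟩
  obtain ⟨m₁, h1, m₂, h2, rfl⟩ := Finset.mem_add.mp (AddMonoidAlgebra.support_coeff_mul_subset a b hm)
  refine hkey m₁ h1 m₂ h2 ?_
  by_contra hcon
  push Not at hcon
  exact hne (by rw [hcon.1, hcon.2])

/-- A nonzero Laurent polynomial has a strict minimum for every weight that is injective on `ℤ²`.
[folklore] -/
theorem exists_smin (hgen : Function.Injective (wt w)) {a : Lau} (ha : a ≠ 0) :
    ∃ x, SMin(w, a, x) := by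
  have hne : a.coeff.support.Nonempty := by
    rw [Finsupp.support_nonempty_iff]
    intro h
    exact ha (AddMonoidAlgebra.coeff_injective (by rw [h]; rfl))
  obtain ⟨x, hx, hmin⟩ := a.coeff.support.exists_min_image (wt w) hne
  refine ⟨x, Finsupp.mem_support_iff.mp hx, fun y hy hyx => ?_⟩
  exact lt_of_le_of_ne (hmin y hy) fun h => hyx (hgen h).symm

/-! ## Heavy elements -/

/-- Monotonicity in the threshold. [folklore] -/
theorem heavy_mono {Ω Ω' : ℝ} {a : Lau} (h : Heavy(w, Ω, a)) (hle : Ω' ≤ Ω) : Heavy(w, Ω', a) :=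
  fun y hy => hle.trans (h y hy)

/-- Zero is heavy. [folklore] -/
theorem heavy_zero (Ω : ℝ) : Heavy(w, Ω, (0 : Lau)) := by
  intro y hy
  simp at hy

/-- A monomial is as heavy as its exponent. [folklore] -/
theorem heavy_single {Ω : ℝ} (z : Fin 2 → ℤ) (c : ℂ) (hz : Ω ≤ wt w z) :
    Heavy(w, Ω, AddMonoidAlgebra.single z c) := by
  intro y hy
  rw [AddMonoidAlgebra.coeff_single] at hy
  have := Finsupp.support_single_subset hy
  rw [Finset.mem_singleton] at this
  rw [this]; exact hz

/-- `1` is `0`-heavy. [folklore] -/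
theorem heavy_one : Heavy(w, 0, (1 : Lau)) := by
  rw [AddMonoidAlgebra.one_def]
  exact heavy_single 0 1 (by rw [wt_zero])

/-- Sums of heavy elements are heavy. [folklore] -/
theorem heavy_add {Ω : ℝ} {a b : Lau} (ha : Heavy(w, Ω, a)) (hb : Heavy(w, Ω, b)) : Heavy(w, Ω, a + b) := by
  classical
  intro y hy
  rw [AddMonoidAlgebra.coeff_add] at hy
  rcases Finset.mem_union.mp (Finsupp.support_add hy) with h | h
  · exact ha y h
  · exact hb y h

/-- Negatives of heavy elements are heavy. [folklore] -/
theorem heavy_neg {Ω : ℝ} {a : Lau} (ha : Heavy(w, Ω, a)) : Heavy(w, Ω, -a) := by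
  intro y hy
  rw [AddMonoidAlgebra.coeff_neg, Finsupp.support_neg] at hy
  exact ha y hy

/-- Differences of heavy elements are heavy. [folklore] -/
theorem heavy_sub {Ω : ℝ} {a b : Lau} (ha : Heavy(w, Ω, a)) (hb : Heavy(w, Ω, b)) : Heavy(w, Ω, a - b) := by
  rw [sub_eq_add_neg]; exact heavy_add ha (heavy_neg hb)

/-- Scalar multiples of heavy elements are heavy. [folklore] -/
theorem heavy_smul {Ω : ℝ} {a : Lau} (ha : Heavy(w, Ω, a)) (c : ℂ) : Heavy(w, Ω, c • a) := by
  intro y hy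
  rw [AddMonoidAlgebra.coeff_smul] at hy
  exact ha y (Finsupp.support_smul hy)

/-- Finite sums of heavy elements are heavy. [folklore] -/
theorem heavy_sum {ι : Type*} {Ω : ℝ} (s : Finset ι) (a : ι → Lau) (ha : ∀ i ∈ s, Heavy(w, Ω, a i)) :
    Heavy(w, Ω, ∑ i ∈ s, a i) := by
  classical
  induction s using Finset.induction_on with
  | empty => rw [Finset.sum_empty]; exact heavy_zero Ω
  | insert j s hj ih =>
    rw [Finset.sum_insert hj]
    exact heavy_add (ha j (Finset.mem_insert_self j s)) (ih fun i hi => ha i (Finset.mem_insert_of_mem hi))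

/-- **Products of heavy elements**: thresholds add. [folklore] -/
theorem heavy_mul {Ω₁ Ω₂ : ℝ} {a b : Lau} (ha : Heavy(w, Ω₁, a)) (hb : Heavy(w, Ω₂, b)) :
    Heavy(w, Ω₁ + Ω₂, a * b) := by
  classical
  intro m hm
  obtain ⟨m₁, h1, m₂, h2, rfl⟩ := Finset.mem_add.mp (AddMonoidAlgebra.support_coeff_mul_subset a b hm)
  rw [wt_add]
  exact add_le_add (ha m₁ h1) (hb m₂ h2)

/-- Finite products of `0`-heavy elements are `0`-heavy. [folklore] -/
theorem heavy_prod {ι : Type*} (s : Finset ι) (a : ι → Lau) (ha : ∀ i ∈ s, Heavy(w, 0, a i)) :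
    Heavy(w, 0, ∏ i ∈ s, a i) := by
  classical
  induction s using Finset.induction_on with
  | empty => rw [Finset.prod_empty]; exact heavy_one
  | insert j s hj ih =>
    rw [Finset.prod_insert hj]
    have := heavy_mul (ha j (Finset.mem_insert_self j s)) (ih fun i hi => ha i (Finset.mem_insert_of_mem hi))
    rwa [add_zero] at this

/-- **Perturbed products.** If every `a i` is `0`-heavy and every perturbation `h i` is `Ω`-heavy
(`Ω ≥ 0`), then `Π (a i + h i) = Π a i + H` with `H` `Ω`-heavy. [folklore] -/
theorem prod_add_heavy {ι : Type*} (s : Finset ι) (a h : ι → Lau) {Ω : ℝ} (hΩ : 0 ≤ Ω)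
    (ha : ∀ i ∈ s, Heavy(w, 0, a i)) (hh : ∀ i ∈ s, Heavy(w, Ω, h i)) :
    ∃ H : Lau, Heavy(w, Ω, H) ∧ ∏ i ∈ s, (a i + h i) = ∏ i ∈ s, a i + H := by
  classical
  induction s using Finset.induction_on with
  | empty => exact ⟨0, heavy_zero Ω, by simp⟩
  | insert j s hj ih =>
    obtain ⟨H, hH, hprod⟩ := ih (fun i hi => ha i (Finset.mem_insert_of_mem hi))
      (fun i hi => hh i (Finset.mem_insert_of_mem hi))
    have haj := ha j (Finset.mem_insert_self j s)
    have hhj := hh j (Finset.mem_insert_self j s)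
    have hP : Heavy(w, 0, ∏ i ∈ s, a i) := heavy_prod s a fun i hi => ha i (Finset.mem_insert_of_mem hi)
    refine ⟨a j * H + h j * ∏ i ∈ s, a i + h j * H, ?_, ?_⟩
    · refine heavy_add (heavy_add ?_ ?_) ?_
      · simpa using heavy_mul haj hH
      · simpa using heavy_mul hhj hP
      · exact heavy_mono (heavy_mul hhj hH) (by linarith)
    · rw [Finset.prod_insert hj, Finset.prod_insert hj, hprod]
      ring


/-- Registered form (`k11_prod_add_heavy`, notation-free) of `prod_add_heavy` over `Fin s`. [folklore] -/
theorem k11_prod_add_heavy (w : Fin 2 → ℝ) (s : ℕ) (a h : Fin s → AddMonoidAlgebra ℂ (Fin 2 → ℤ)) (Ω : ℝ) (hΩ : 0 ≤ Ω) (ha : ∀ i, ∀ y ∈ (a i).coeff.support, 0 ≤ wt w y) (hh : ∀ i, ∀ y ∈ (h i).coeff.support, Ω ≤ wt w y) : ∃ H : AddMonoidAlgebra ℂ (Fin 2 → ℤ), (∀ y ∈ H.coeff.support, Ω ≤ wt w y) ∧ ∏ i, (a i + h i) = ∏ i, a i + H :=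
  prod_add_heavy Finset.univ a h hΩ (fun i _ => ha i) (fun i _ => hh i)
-- END BODY
end Summit.ValiantsHypothesis.ValiantsHypothesis.Theorems.NewtonTauWeakK3Lines

end
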